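import Literature.Topology.FourManifolds.FoldChartSigFibred
import Literature.Topology.FourManifolds.FoldPoint
import Literature.Topology.FourManifolds.RankOneMapJets
import Literature.Topology.FourManifolds.RankOneFoldPoint
import Literature.Topology.FourManifolds.OneJetGenericMapsExist
import Literature.Topology.FourManifolds.RankOneNormalForm
import HarnessLib

/-!
# Every fold point of a map `ℝ⁴ → ℝ²` has a fold chart `(t, ±x² ± y² ± z²)`

Topic `Literature/Topology/FourManifolds` (programme of the fact
`Literature.Topology.FourManifolds.exists_isSimplifiedBrokenLefschetzFibration`, Baykur–Saeki 2017, §2.1: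
folds `(t, ±x² ± y² ± z²)`, definite or indefinite).  The indefinite lane
(`IntrinsicFoldCriterion.hasIndefiniteFoldChart_of_kerHessian`) needed the kernel Hessian to take
both signs.  Here the sign hypothesis is dropped: a **fold point** of a `C^∞` map
`F : ℝ⁴ → ℝ²` (rank one, kernel Hessian `ℓ D²F(p)|_{Ker dF_p}` nondegenerate — Golubitsky–
Guillemin III Def. 4.1 / VI (2.1)(a)) has a fold chart of SOME signature `(±1, ±1, ±1)`
(`HasFoldChartSig`), by the rank-one charts, the reading of the fold condition on the fibre
function, and `exists_hasFoldChartSig_fibredMap`.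

* `OneJet.isFoldPointAt_rankOneMap_iff` — in rank-one form: critical and the fibre Hessian of `f`
  on `{v | v₀ = 0}` is nondegenerate;
* `HasFoldChartSig.congr_of_eventuallyEq`, `HasFoldChartSig.of_localRepresentative`;
* **`exists_hasFoldChartSig_of_isFoldPointAt`** — the chart at every fold point.

Everything is proved; no definitions, no named facts (D-0026).

## References

* M. Golubitsky, V. Guillemin, *Stable Mappings and Their Singularities*, GTM 14 (1973), Ch. III
  §4, Def. 4.1 and Thm. 4.5; Ch. VI §2, (2.1)(a), Thm. 2.2. [GolubitskyGuillemin1973]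
* R. İ. Baykur, O. Saeki, *Simplifying indefinite fibrations on 4-manifolds*, arXiv:1705.11169,
  §2.1, p. 6. [BaykurSaeki2017]
-/

noncomputable section

set_option maxSynthPendingDepth 2

open Set Function Filter Module
open scoped ContDiff Topology

namespace Literature.Topology.FourManifolds

namespace OneJet


section RankOne

/-- Local notation for this file: the model space `ℝⁿ = EuclideanSpace ℝ (Fin n)`. -/
local notation "𝔼 " n:arg => EuclideanSpace ℝ (Fin n)

/-- **Fold points in rank-one form**: `y` is a fold point of `y ↦ (y₀, f y)` iff `df_y` kills
the fibre `{v | v₀ = 0}` and the fibre Hessian `D²f_y|_{v₀ = 0}` is nondegenerate.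
[cite: GolubitskyGuillemin1973, Ch. VI §2, (2.1)(a)] -/
theorem isFoldPointAt_rankOneMap_iff {f : 𝔼 4 → ℝ} {Ω : Set (𝔼 4)} (hΩ : IsOpen Ω)
    (hf : ContDiffOn ℝ ∞ f Ω) {y : 𝔼 4} (hy : y ∈ Ω) :
    IsFoldPointAt (rankOneMap f) y ↔
      (∀ v : 𝔼 4, v 0 = 0 → fderiv ℝ f y v = 0) ∧
        ∀ k₀ : 𝔼 4, k₀ 0 = 0 → (∀ k : 𝔼 4, k 0 = 0 → fderiv ℝ (fderiv ℝ f) y k k₀ = 0) → k₀ = 0 := by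
  have hfd : DifferentiableAt ℝ f y := (hf.contDiffAt (hΩ.mem_nhds hy)).differentiableAt (by simp)
  rw [isFoldPointAt_iff, not_surjective_fderiv_rankOneMap_iff hfd]
  refine and_congr_right fun hcrit => ?_
  have hker := fderiv_rankOneMap_apply_eq_zero_iff hfd hcrit
  constructor
  · intro h k₀ hk₀ hrad
    refine h _ (cokernelCovector_ne_zero f y) (cokernelCovector_comp_fderiv hfd hcrit) k₀
      ((hker k₀).2 hk₀) fun k hk => ?_
    rw [cokernelCovector_fderiv_fderiv_rankOneMap hΩ hf hy]
    exact hrad k ((hker k).1 hk)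
  · intro h ℓ hℓ hℓG k₀ hk₀ hrad
    obtain ⟨a, rfl⟩ := exists_eq_smul_cokernelCovector hfd hcrit hℓG
    have ha : a ≠ 0 := by
      rintro rfl
      exact hℓ (zero_smul _ _)
    refine h k₀ ((hker k₀).1 hk₀) fun k hk => ?_
    have h1 := hrad k ((hker k).2 hk)
    rw [_root_.smul_apply, cokernelCovector_fderiv_fderiv_rankOneMap hΩ hf hy, smul_eq_mul,
      mul_eq_zero] at h1
    exact h1.resolve_left ha

end RankOne

end OneJet

/-! ### The chart at a fold point -/

section Chart

/-- Local notation for this file: the model space `ℝⁿ = EuclideanSpace ℝ (Fin n)`. -/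
local notation "𝔼 " n:arg => EuclideanSpace ℝ (Fin n)

/-- **The chart condition is local.** [folklore] -/
theorem HasFoldChartSig.congr_of_eventuallyEq {F₁ F₂ : 𝔼 4 → 𝔼 2} {y : 𝔼 4} {s₁ s₂ s₃ : ℝ}
    (h : HasFoldChartSig F₁ y s₁ s₂ s₃) (heq : F₁ =ᶠ[𝓝 y] F₂) : HasFoldChartSig F₂ y s₁ s₂ s₃ := by
  obtain ⟨φ, ψ, hy, hy0, hmaps, hφ, hφs, hψ, hψs, hid⟩ := h
  obtain ⟨S, hSsub, hSo, hyS⟩ : ∃ S ⊆ {q | F₁ q = F₂ q}, IsOpen S ∧ y ∈ S :=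
    _root_.mem_nhds_iff.1 heq
  have hsrc : (φ.restrOpen S hSo).source = φ.source ∩ S :=
    OpenPartialHomeomorph.restrOpen_source φ S hSo
  have htgt : (φ.restrOpen S hSo).target ⊆ φ.target := by
    intro z hz
    have h1 : (φ.restrOpen S hSo).symm z ∈ (φ.restrOpen S hSo).source :=
      (φ.restrOpen S hSo).map_target hz
    have h2 : (φ.restrOpen S hSo) ((φ.restrOpen S hSo).symm z) = z :=
      (φ.restrOpen S hSo).right_inv hz
    rw [hsrc] at h1
    have h3 : φ (φ.symm z) = z := h2
    rw [← h3]
    exact φ.map_source h1.1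
  refine ⟨φ.restrOpen S hSo, ψ, ?_, hy0, ?_, ?_, hφs.mono htgt, hψ, hψs, ?_⟩
  · rw [hsrc]
    exact ⟨hy, hyS⟩
  · intro q hq
    rw [hsrc] at hq
    rw [← show F₁ q = F₂ q from hSsub hq.2]
    exact hmaps hq.1
  · rw [hsrc]
    exact hφ.mono inter_subset_left
  · intro q hq
    rw [hsrc] at hq
    rw [← show F₁ q = F₂ q from hSsub hq.2]
    exact hid q hq.1

/-- **The chart condition is invariant under smooth local coordinate changes.** [folklore] -/
theorem HasFoldChartSig.of_localRepresentative {F : 𝔼 4 → 𝔼 2} {p : 𝔼 4} {s₁ s₂ s₃ : ℝ}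
    {Φ₀ : OpenPartialHomeomorph (𝔼 4) (𝔼 4)} {Ψ₀ : OpenPartialHomeomorph (𝔼 2) (𝔼 2)}
    (hΦ₀ : ContDiffOn ℝ ∞ Φ₀ Φ₀.source) (hΦ₀s : ContDiffOn ℝ ∞ Φ₀.symm Φ₀.target)
    (hΨ₀ : ContDiffOn ℝ ∞ Ψ₀ Ψ₀.source) (hΨ₀s : ContDiffOn ℝ ∞ Ψ₀.symm Ψ₀.target)
    (hmaps : MapsTo F Φ₀.source Ψ₀.source) (hp : p ∈ Φ₀.source)
    (h : HasFoldChartSig (Ψ₀ ∘ F ∘ Φ₀.symm) (Φ₀ p) s₁ s₂ s₃) : HasFoldChartSig F p s₁ s₂ s₃ := by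
  obtain ⟨φm, ψm, hpm, hpm0, hmapsm, hφm, hφms, hψm, hψms, hid⟩ := h
  have hFq : ∀ q ∈ Φ₀.source, (Ψ₀ ∘ F ∘ Φ₀.symm) (Φ₀ q) = Ψ₀ (F q) := fun q hq => by
    simp only [Function.comp_apply, Φ₀.left_inv hq]
  refine ⟨Φ₀.trans φm, Ψ₀.trans ψm, ?_, ?_, ?_, ?_, ?_, ?_, ?_, ?_⟩
  · rw [OpenPartialHomeomorph.trans_source]
    exact ⟨hp, hpm⟩
  · rw [OpenPartialHomeomorph.coe_trans, Function.comp_apply, hpm0]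
  · intro q hq
    rw [OpenPartialHomeomorph.trans_source] at hq ⊢
    refine ⟨hmaps hq.1, ?_⟩
    show Ψ₀ (F q) ∈ ψm.source
    rw [← hFq q hq.1]
    exact hmapsm hq.2
  · rw [OpenPartialHomeomorph.trans_source, OpenPartialHomeomorph.coe_trans]
    exact hφm.comp (hΦ₀.mono inter_subset_left) fun q hq => hq.2
  · rw [OpenPartialHomeomorph.trans_symm_eq_symm_trans_symm, OpenPartialHomeomorph.trans_target,
      OpenPartialHomeomorph.coe_trans]
    exact hΦ₀s.comp (hφms.mono inter_subset_left) fun y hy => hy.2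
  · rw [OpenPartialHomeomorph.trans_source, OpenPartialHomeomorph.coe_trans]
    exact hψm.comp (hΨ₀.mono inter_subset_left) fun q hq => hq.2
  · rw [OpenPartialHomeomorph.trans_symm_eq_symm_trans_symm, OpenPartialHomeomorph.trans_target,
      OpenPartialHomeomorph.coe_trans]
    exact hΨ₀s.comp (hψms.mono inter_subset_left) fun y hy => hy.2
  · intro q hq
    rw [OpenPartialHomeomorph.trans_source] at hq
    simp only [OpenPartialHomeomorph.coe_trans, Function.comp_apply]
    have h := hid (Φ₀ q) hq.2
    rw [hFq q hq.1] at h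
    exact h

/-- The fibred map of `f ∘ unfibre` is the rank-one map of `f`. [folklore] -/
theorem fibredMap_comp_unfibre (f : 𝔼 4 → ℝ) : fibredMap (f ∘ unfibre) = OneJet.rankOneMap f := by
  funext q
  simp [fibredMap, OneJet.rankOneMap_apply, unfibre_fibrePart]

/-- `2 ≤ ∞` in `WithTop ℕ∞`. [folklore] -/
private theorem two_le_infty₇ : (2 : WithTop ℕ∞) ≤ ∞ := WithTop.coe_le_coe.2 le_top

/-- **Every fold point has a fold chart of some signature.**  Let `F : ℝ⁴ → ℝ²` be `C^∞` with
`dF_p ≠ 0` and `p` a fold point (`OneJet.IsFoldPointAt`: rank one, nondegenerate kernel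
Hessian).  Then for some signs `s₁, s₂, s₃ = ±1` there are centred smooth charts with
`ψ ∘ F ∘ φ⁻¹ = (t, s₁x² + s₂y² + s₃z²)` — Baykur–Saeki's fold model, definite or indefinite.
[cite: BaykurSaeki2017, §2.1, p. 6] [cite: GolubitskyGuillemin1973, Ch. III §4, Thm. 4.5] -/
theorem exists_hasFoldChartSig_of_isFoldPointAt {F : 𝔼 4 → 𝔼 2} (hF : ContDiff ℝ ∞ F) {p : 𝔼 4}
    (hp : fderiv ℝ F p ≠ 0) (hfold : OneJet.IsFoldPointAt F p) :
    ∃ s₁ s₂ s₃ : ℝ, s₁ ^ 2 = 1 ∧ s₂ ^ 2 = 1 ∧ s₃ ^ 2 = 1 ∧ HasFoldChartSig F p s₁ s₂ s₃ := by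
  -- rank-one charts and cut-off globalisation
  obtain ⟨φ, ψ, f, hpφ, hp0, hmaps, hφ, hφs, hψ, hψs, hf, hid⟩ := exists_rankOne_charts hF hp
  have h0t : (0 : 𝔼 4) ∈ φ.target := hp0 ▸ φ.map_source hpφ
  obtain ⟨χ, hχ, hχt, hχ1⟩ :=
    Literature.Analysis.Calculus.exists_contDiff_bump_nhds φ.open_target h0t
  set fc : 𝔼 4 → ℝ := fun y => χ y * f y with hfc
  have hfcs : ContDiff ℝ ∞ fc := by
    rw [contDiff_iff_contDiffAt]
    intro y
    by_cases hy : y ∈ φ.target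
    · exact hχ.contDiffAt.mul (hf.contDiffAt (φ.open_target.mem_nhds hy))
    · have hy' : y ∉ tsupport χ := fun h => hy (hχt h)
      have hev : fc =ᶠ[𝓝 y] fun _ => 0 := by
        filter_upwards [(isClosed_tsupport χ).isOpen_compl.mem_nhds hy'] with z hz
        show χ z * f z = 0
        rw [image_eq_zero_of_notMem_tsupport hz, zero_mul]
      exact (contDiffAt_const (c := (0 : ℝ))).congr_of_eventuallyEq hev
  have hrep : OneJet.rankOneMap fc =ᶠ[𝓝 (0 : 𝔼 4)] (ψ ∘ F ∘ φ.symm) := by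
    filter_upwards [φ.open_target.mem_nhds h0t, hχ1] with y hy hχy
    have hq : φ.symm y ∈ φ.source := φ.map_target hy
    obtain ⟨h0', h1'⟩ := hid (φ.symm y) hq
    rw [φ.right_inv hy] at h0' h1'
    ext i
    fin_cases i
    · show OneJet.rankOneMap fc y 0 = ψ (F (φ.symm y)) 0
      rw [OneJet.rankOneMap_apply_zero, h0']
    · show OneJet.rankOneMap fc y 1 = ψ (F (φ.symm y)) 1
      rw [OneJet.rankOneMap_apply_one, h1']
      show χ y * f y = f y
      rw [hχy, one_mul]
  -- the fold condition transported to `rankOneMap fc` at `0` and read on `fc`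
  obtain ⟨A, -, hA⟩ := exists_fderiv_continuousLinearEquiv φ hφ hφs (by simp) hpφ
  rw [hp0] at hA
  have hpψ : F p ∈ ψ.source := hmaps hpφ
  obtain ⟨B, hB, -⟩ := exists_fderiv_continuousLinearEquiv ψ hψ hψs (by simp) hpψ
  have hφs2 : ContDiffAt ℝ 2 φ.symm 0 :=
    (hφs.contDiffAt (φ.open_target.mem_nhds h0t)).of_le two_le_infty₇
  have hψ2 : ContDiffAt ℝ 2 ψ (F p) := (hψ.contDiffAt (ψ.open_source.mem_nhds hpψ)).of_le two_le_infty₇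
  have hF2 : ContDiffAt ℝ 2 F p := hF.contDiffAt.of_le two_le_infty₇
  have hp' : φ.symm 0 = p := by rw [← hp0, φ.left_inv hpφ]
  have hψF2 : ContDiffAt ℝ 2 (ψ ∘ F) (φ.symm 0) := by
    rw [hp']
    exact hψ2.comp p hF2
  have hfold' : OneJet.IsFoldPointAt (OneJet.rankOneMap fc) 0 := by
    rw [OneJet.isFoldPointAt_congr_of_eventuallyEq hrep,
      show ψ ∘ F ∘ φ.symm = (ψ ∘ F) ∘ φ.symm from rfl,
      OneJet.isFoldPointAt_comp_iff A.symm hA hφs2 hψF2, hp',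
      OneJet.isFoldPointAt_comp_target_iff B hB hψ2 hF2]
    exact hfold
  obtain ⟨hcrit, hnd⟩ :=
    (OneJet.isFoldPointAt_rankOneMap_iff isOpen_univ hfcs.contDiffOn (mem_univ 0)).1 hfold'
  -- the fibre function `g = fc ∘ unfibre`
  set g : ℝ × 𝔼 3 → ℝ := fc ∘ unfibre with hg
  have hgs : ContDiff ℝ ∞ g := hfcs.comp unfibre.contDiff
  have hunf0 : unfibre ((0 : ℝ), (0 : 𝔼 3)) = 0 := map_zero unfibre
  have hd1 : ∀ z, fderiv ℝ g ((0 : ℝ), (0 : 𝔼 3)) z = fderiv ℝ fc 0 (unfibre z) := fun z => by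
    have hd : HasFDerivAt g ((fderiv ℝ fc 0).comp unfibre) ((0 : ℝ), (0 : 𝔼 3)) := by
      have h0 : HasFDerivAt fc (fderiv ℝ fc 0) (unfibre ((0 : ℝ), (0 : 𝔼 3))) := by
        rw [hunf0]
        exact (hfcs.differentiable (by simp) 0).hasFDerivAt
      exact h0.comp _ unfibre.hasFDerivAt
    rw [hd.fderiv, ContinuousLinearMap.comp_apply]
  have hd2 : ∀ z w, fderiv ℝ (fderiv ℝ g) ((0 : ℝ), (0 : 𝔼 3)) z w =
      fderiv ℝ (fderiv ℝ fc) 0 (unfibre z) (unfibre w) := by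
    intro z w
    have hτ2 : ContDiffAt ℝ 2 (unfibre : ℝ × 𝔼 3 → 𝔼 4) ((0 : ℝ), (0 : 𝔼 3)) :=
      unfibre.contDiff.contDiffAt.of_le two_le_infty₇
    have hfc2 : ContDiffAt ℝ 2 fc (unfibre ((0 : ℝ), (0 : 𝔼 3))) := hfcs.contDiffAt.of_le two_le_infty₇
    rw [hg, fderiv_fderiv_comp_apply_eq_add hfc2 hτ2 z w]
    have h0 : fderiv ℝ (fderiv ℝ (unfibre : ℝ × 𝔼 3 → 𝔼 4)) ((0 : ℝ), (0 : 𝔼 3)) z w = 0 := by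
      have : fderiv ℝ (unfibre : ℝ × 𝔼 3 → 𝔼 4) = fun _ => unfibre := by
        funext q'
        exact unfibre.fderiv
      rw [this]
      simp
    rw [h0, map_zero, zero_add, unfibre.fderiv, hunf0]
  have hx0 : ((0 : 𝔼 4) 0, fibrePart (0 : 𝔼 4)) = ((0 : ℝ), (0 : 𝔼 3)) := by simp
  have hcrit' : fibreGrad g ((0 : 𝔼 4) 0, fibrePart (0 : 𝔼 4)) = 0 := by
    rw [hx0]
    ext i
    rw [fibreGrad_apply, hd1]
    exact hcrit _ (by simp)
  have hH' : ∀ a : 𝔼 3, (∀ b, fibreHessian g ((0 : 𝔼 4) 0, fibrePart (0 : 𝔼 4)) a b = 0) → a = 0 := by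
    rw [hx0]
    intro a ha
    have hk0 : unfibre ((0 : ℝ), a) 0 = 0 := by simp
    have hk : unfibre ((0 : ℝ), a) = 0 := by
      refine hnd _ hk0 fun k hk => ?_
      have hkeq : k = unfibre ((0 : ℝ), fibrePart k) := by
        conv_lhs => rw [← unfibre_fibrePart k, hk]
      have h1 := ha (fibrePart k)
      rw [fibreHessian_apply, hd2] at h1
      have hsymm : fderiv ℝ (fderiv ℝ fc) 0 (unfibre ((0 : ℝ), fibrePart k)) (unfibre ((0 : ℝ), a)) =
          fderiv ℝ (fderiv ℝ fc) 0 (unfibre ((0 : ℝ), a)) (unfibre ((0 : ℝ), fibrePart k)) :=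
        (hfcs.contDiffAt.isSymmSndFDerivAt
          (by simp only [minSmoothness_of_isRCLikeNormedField]; exact two_le_infty₇)) _ _
      rw [hkeq, hsymm]
      exact h1
    have := congrArg fibrePart hk
    simpa using this
  -- the chart of the fibred map, transported back
  obtain ⟨s₁, s₂, s₃, hs₁, hs₂, hs₃, hchart⟩ := exists_hasFoldChartSig_fibredMap hgs hcrit' hH'
  rw [hg, fibredMap_comp_unfibre] at hchart
  refine ⟨s₁, s₂, s₃, hs₁, hs₂, hs₃, ?_⟩
  have h₀ : HasFoldChartSig (ψ ∘ F ∘ φ.symm) (φ p) s₁ s₂ s₃ := by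
    rw [hp0]
    exact hchart.congr_of_eventuallyEq hrep
  exact HasFoldChartSig.of_localRepresentative hφ hφs hψ hψs hmaps hpφ h₀

end Chart

end Literature.Topology.FourManifolds
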